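import Summits.KontsevichZagierPeriods.KontsevichZagierPeriods.Theorems.SoloBlindLegendreModulus
import Literature.NumberTheory.Transcendental.SemialgebraicLineDeriv
import HarnessLib

/-!
# Legendre's relation inside the rules, I: the Legendre form and its modulus derivative

For a modulus-square `μ ∈ (0,1)` write `P = 1-x²`, `Q = 1-μx²`, `R = 1-y²`,
`S = 1-(1-μ)y²`, `u = PQRS` and `t = √u`.  The **Legendre form**

  `F(x,y,μ) = (μP + (1-μ)R)/t = f_K(x) g_E(y) + f_E(x) g_K(y) - f_K(x) g_K(y)`

(`f_K = 1/√(PQ)`, `f_E = Q/√(PQ)` the Legendre normal forms at `k² = μ`; `g_K`, `g_E` those at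
the complementary `k'² = 1-μ`) has `∫∫_{(0,1)²} F = E K' + E' K - K K'`, the left side of
Legendre's relation `E K' + E' K - K K' = π/2`.  This file is pure calculus on the functions

  `F`,  `G = x y² P/(2t)`,  `H = -x² y R/(2t)`

and the closed forms `legGx = ∂G/∂x`, `legHy = ∂H/∂y` over the common denominator `2ut`:

* **the divergence identity** `∂F/∂μ = ∂G/∂x + ∂H/∂y` (`hasDerivAt_legF`, with
  `legFμ := legGx + legHy` by definition, together with `hasDerivAt_legG`, `hasDerivAt_legH`);
* `G(0,y,μ) = G(1,y,μ) = 0`, `H(x,0,μ) = H(x,1,μ) = 0` and continuity of the fluxes on the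
  closed fibres `[0,1]`;
* the symmetry `(x,y,μ) ↔ (y,x,1-μ)` exchanging `G` and `-H`;
* `ℚ`-semialgebraicity of all six functions composed with arbitrary semialgebraic arguments.

In part II these feed ONE Newton–Leibniz move along the modulus axis and two boundary-flux
moves, which deform `[(0,1)², F(·,·,μ)]` in `μ` without changing its class in `Q`.
References: A.-M. Legendre, *Exercices de calcul intégral* I (1811), §§ on the complete
integrals; Kontsevich–Zagier, *Periods* (2001), §1.2 (the rules).
-/

noncomputable section

namespace Summit.KontsevichZagierPeriods.KontsevichZagierPeriods.Theorems

open Set MeasureTheory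
open Literature.ModelTheory.ExponentialFields (IsSemialgebraic)
open Literature.NumberTheory.Transcendental
open Literature.NumberTheory.Transcendental.KZ

namespace SoloBlind

/-! ## The functions -/

/-- The radicand `u(x,y,μ) = (1-x²)(1-μx²)(1-y²)(1-(1-μ)y²)`. -/
def legU (x y μ : ℝ) : ℝ :=
  (1 - x ^ 2) * (1 - μ * x ^ 2) * (1 - y ^ 2) * (1 - (1 - μ) * y ^ 2)

/-- `t = √u`. -/
def legT (x y μ : ℝ) : ℝ := Real.sqrt (legU x y μ)

/-- The Legendre form `F(x,y,μ) = (μ(1-x²) + (1-μ)(1-y²))/√u`. -/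
def legF (x y μ : ℝ) : ℝ := (μ * (1 - x ^ 2) + (1 - μ) * (1 - y ^ 2)) / legT x y μ

/-- The `x`-flux `G(x,y,μ) = x y² (1-x²)/(2√u)`. -/
def legG (x y μ : ℝ) : ℝ := x * y ^ 2 * (1 - x ^ 2) / (2 * legT x y μ)

/-- The `y`-flux `H(x,y,μ) = -x² y (1-y²)/(2√u)`. -/
def legH (x y μ : ℝ) : ℝ := -(x ^ 2 * y * (1 - y ^ 2)) / (2 * legT x y μ)

/-- `∂G/∂x` in closed form over the denominator `2u√u`. -/
def legGx (x y μ : ℝ) : ℝ :=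
  y ^ 2 * (1 - x ^ 2) * (1 - y ^ 2) * (1 - (1 - μ) * y ^ 2) * (1 - 2 * x ^ 2 + μ * x ^ 4) /
    (2 * legU x y μ * legT x y μ)

/-- `∂H/∂y` in closed form over the denominator `2u√u`. -/
def legHy (x y μ : ℝ) : ℝ :=
  -(x ^ 2 * (1 - x ^ 2) * (1 - μ * x ^ 2) * (1 - y ^ 2) * (1 - 2 * y ^ 2 + (1 - μ) * y ^ 4)) /
    (2 * legU x y μ * legT x y μ)

/-- `∂F/∂μ`, *defined* as `∂G/∂x + ∂H/∂y`; that it is the `μ`-derivative of `F` is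
`hasDerivAt_legF`. -/
def legFμ (x y μ : ℝ) : ℝ := legGx x y μ + legHy x y μ

/-! ## Symmetry `(x,y,μ) ↔ (y,x,1-μ)` and boundary values -/

section algebra

variable (x y μ : ℝ)

/-- `u` is symmetric. -/
theorem legU_swap : legU y x (1 - μ) = legU x y μ := by
  unfold legU; ring

/-- `t` is symmetric. -/
theorem legT_swap : legT y x (1 - μ) = legT x y μ := by
  rw [legT, legT, legU_swap]

/-- `F` is symmetric. -/
theorem legF_swap : legF y x (1 - μ) = legF x y μ := by
  rw [legF, legF, legT_swap]; ring

/-- `H` is `-G` with the roles of `x` and `y` exchanged. -/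
theorem legH_eq : legH x y μ = -legG y x (1 - μ) := by
  rw [legH, legG, legT_swap]; ring

/-- `∂H/∂y` is `-∂G/∂x` with the roles of `x` and `y` exchanged. -/
theorem legHy_eq : legHy x y μ = -legGx y x (1 - μ) := by
  rw [legHy, legGx, legT_swap, legU_swap]; ring

/-- `G(0,y,μ) = 0`. -/
theorem legG_zero_left : legG 0 y μ = 0 := by simp [legG]

/-- `G(1,y,μ) = 0`. -/
theorem legG_one_left : legG 1 y μ = 0 := by simp [legG]

/-- `H(x,0,μ) = 0`. -/
theorem legH_zero : legH x 0 μ = 0 := by simp [legH]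

/-- `H(x,1,μ) = 0`. -/
theorem legH_one : legH x 1 μ = 0 := by simp [legH]

end algebra

/-! ## Positivity and the derivatives -/

section calculus

variable {x y μ : ℝ}

/-- `u > 0` when `x² < 1`, `y² < 1`, `0 ≤ μ ≤ 1`. -/
theorem legU_pos (hx : x ^ 2 < 1) (hy : y ^ 2 < 1) (hμ : μ ∈ Icc (0:ℝ) 1) :
    0 < legU x y μ := by
  have h1 : 0 < 1 - μ * x ^ 2 := by nlinarith [hμ.1, hμ.2, sq_nonneg x]
  have h2 : 0 < 1 - (1 - μ) * y ^ 2 := by nlinarith [hμ.1, hμ.2, sq_nonneg y]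
  exact mul_pos (mul_pos (mul_pos (sub_pos.mpr hx) h1) (sub_pos.mpr hy)) h2

/-- `t > 0` under the same hypotheses. -/
theorem legT_pos (hx : x ^ 2 < 1) (hy : y ^ 2 < 1) (hμ : μ ∈ Icc (0:ℝ) 1) : 0 < legT x y μ :=
  Real.sqrt_pos.mpr (legU_pos hx hy hμ)

/-- The one-variable rule `(A/√u)' = (2A'u - Au')/(2u√u)` at a point where `u > 0`. -/
theorem hasDerivAt_div_sqrt {A u : ℝ → ℝ} {A' u' x : ℝ} (hA : HasDerivAt A A' x)
    (hu : HasDerivAt u u' x) (hpos : 0 < u x) :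
    HasDerivAt (fun s => A s / Real.sqrt (u s))
      ((2 * A' * u x - A x * u') / (2 * u x * Real.sqrt (u x))) x := by
  have ht : 0 < Real.sqrt (u x) := Real.sqrt_pos.mpr hpos
  have hsq : Real.sqrt (u x) ^ 2 = u x := Real.sq_sqrt hpos.le
  refine (hA.div (hu.sqrt hpos.ne') ht.ne').congr_deriv ?_
  generalize Real.sqrt (u x) = t at ht hsq ⊢
  rw [← hsq]
  field_simp

/-- `∂u/∂x`. -/
theorem hasDerivAt_legU_left (x y μ : ℝ) : HasDerivAt (fun s => legU s y μ)
    ((-(2 * x) * (1 - μ * x ^ 2) + (1 - x ^ 2) * (-(μ * (2 * x)))) * (1 - y ^ 2) *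
      (1 - (1 - μ) * y ^ 2)) x := by
  have hsq : HasDerivAt (fun s : ℝ => s ^ 2) (2 * x) x := by simpa using hasDerivAt_pow 2 x
  unfold legU
  exact (((hsq.const_sub 1).mul ((hsq.const_mul μ).const_sub 1)).mul_const _).mul_const _

/-- `∂u/∂μ`. -/
theorem hasDerivAt_legU_right (x y μ : ℝ) : HasDerivAt (fun m => legU x y m)
    ((1 - x ^ 2) * (-(1 * x ^ 2)) * (1 - y ^ 2) * (1 - (1 - μ) * y ^ 2) +
      (1 - x ^ 2) * (1 - μ * x ^ 2) * (1 - y ^ 2) * (-(-1 * y ^ 2))) μ := by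
  have hQ : HasDerivAt (fun m : ℝ => 1 - m * x ^ 2) (-(1 * x ^ 2)) μ :=
    ((hasDerivAt_id' μ).mul_const _).const_sub 1
  have hS : HasDerivAt (fun m : ℝ => 1 - (1 - m) * y ^ 2) (-(-1 * y ^ 2)) μ :=
    (((hasDerivAt_id' μ).const_sub 1).mul_const _).const_sub 1
  unfold legU
  exact ((hQ.const_mul _).mul_const _).mul hS

/-- **`∂G/∂x = legGx`** on the open fibre. -/
theorem hasDerivAt_legG (hx : x ^ 2 < 1) (hy : y ^ 2 < 1) (hμ : μ ∈ Icc (0:ℝ) 1) :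
    HasDerivAt (fun s => legG s y μ) (legGx x y μ) x := by
  have hsq : HasDerivAt (fun s : ℝ => s ^ 2) (2 * x) x := by simpa using hasDerivAt_pow 2 x
  have hA : HasDerivAt (fun s : ℝ => s * y ^ 2 * (1 - s ^ 2) / 2)
      ((1 * y ^ 2 * (1 - x ^ 2) + x * y ^ 2 * (-(2 * x))) / 2) x :=
    (((hasDerivAt_id' x).mul_const _).mul (hsq.const_sub 1)).div_const 2
  have h := hasDerivAt_div_sqrt hA (hasDerivAt_legU_left x y μ) (legU_pos hx hy hμ)
  have hfun : (fun s => legG s y μ) =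
      fun s => s * y ^ 2 * (1 - s ^ 2) / 2 / Real.sqrt (legU s y μ) := by
    funext s; simp only [legG, legT]; ring
  rw [hfun]
  refine h.congr_deriv ?_
  simp only [legGx, legT]
  congr 1
  unfold legU
  ring

/-- **`∂H/∂y = legHy`** on the open fibre (from `hasDerivAt_legG` by symmetry). -/
theorem hasDerivAt_legH (hx : x ^ 2 < 1) (hy : y ^ 2 < 1) (hμ : μ ∈ Icc (0:ℝ) 1) :
    HasDerivAt (fun s => legH x s μ) (legHy x y μ) y := by
  have hμ' : 1 - μ ∈ Icc (0:ℝ) 1 := ⟨sub_nonneg.mpr hμ.2, sub_le_self _ hμ.1⟩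
  have h := (hasDerivAt_legG hy hx hμ' (y := x)).neg
  rw [legHy_eq]
  refine HasDerivAt.congr_of_eventuallyEq h (Filter.Eventually.of_forall fun s => ?_)
  exact legH_eq x s μ

/-- **The divergence identity `∂F/∂μ = ∂G/∂x + ∂H/∂y`** on the open square, for every
`μ ∈ [0,1]`: the `μ`-derivative of `F` is `legFμ = legGx + legHy`. -/
theorem hasDerivAt_legF (hx : x ^ 2 < 1) (hy : y ^ 2 < 1) (hμ : μ ∈ Icc (0:ℝ) 1) :
    HasDerivAt (fun m => legF x y m) (legFμ x y μ) μ := by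
  have hN : HasDerivAt (fun m : ℝ => m * (1 - x ^ 2) + (1 - m) * (1 - y ^ 2))
      (1 * (1 - x ^ 2) + -1 * (1 - y ^ 2)) μ :=
    ((hasDerivAt_id' μ).mul_const _).add (((hasDerivAt_id' μ).const_sub 1).mul_const _)
  have h := hasDerivAt_div_sqrt hN (hasDerivAt_legU_right x y μ) (legU_pos hx hy hμ)
  have hfun : (fun m => legF x y m) =
      fun m => (m * (1 - x ^ 2) + (1 - m) * (1 - y ^ 2)) / Real.sqrt (legU x y m) := rfl
  rw [hfun]
  refine h.congr_deriv ?_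
  simp only [legFμ, legGx, legHy, legT]
  rw [← add_div]
  congr 1
  unfold legU
  ring

/-! ## Continuity of the fluxes on the closed fibres -/

/-- On `[0,1]`, `G(·,y,μ)` agrees with a manifestly continuous function (at `s = 1` both
vanish). -/
theorem legG_eq_cont {s : ℝ} (hs : s ∈ Icc (0:ℝ) 1) :
    legG s y μ = s * y ^ 2 * Real.sqrt (1 - s ^ 2) /
      (2 * Real.sqrt ((1 - μ * s ^ 2) * (1 - y ^ 2) * (1 - (1 - μ) * y ^ 2))) := by
  rcases hs.2.eq_or_lt with rfl | h1
  · simp [legG]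
  · have hP : 0 < 1 - s ^ 2 := by nlinarith [hs.1]
    rw [legG, legT, legU, show (1 - s ^ 2) * (1 - μ * s ^ 2) * (1 - y ^ 2) *
      (1 - (1 - μ) * y ^ 2) = (1 - s ^ 2) * ((1 - μ * s ^ 2) * (1 - y ^ 2) *
      (1 - (1 - μ) * y ^ 2)) by ring, Real.sqrt_mul hP.le]
    rw [show s * y ^ 2 * (1 - s ^ 2) / (2 * (Real.sqrt (1 - s ^ 2) *
      Real.sqrt ((1 - μ * s ^ 2) * (1 - y ^ 2) * (1 - (1 - μ) * y ^ 2)))) =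
      s * y ^ 2 / (2 * Real.sqrt ((1 - μ * s ^ 2) * (1 - y ^ 2) * (1 - (1 - μ) * y ^ 2))) *
      ((1 - s ^ 2) / Real.sqrt (1 - s ^ 2)) by ring, Real.div_sqrt]
    ring

/-- `G(·,y,μ)` is continuous on the closed fibre `[0,1]`. -/
theorem continuousOn_legG (hy : y ^ 2 < 1) (hμ : μ ∈ Ioo (0:ℝ) 1) :
    ContinuousOn (fun s => legG s y μ) (Icc 0 1) := by
  have hc : ∀ s ∈ Icc (0:ℝ) 1,
      0 < (1 - μ * s ^ 2) * (1 - y ^ 2) * (1 - (1 - μ) * y ^ 2) := by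
    intro s hs
    have hs2 : s ^ 2 ≤ 1 := pow_le_one₀ hs.1 hs.2
    have h1 : 0 < 1 - μ * s ^ 2 := by nlinarith [hμ.1, hμ.2, sq_nonneg s]
    have h2 : 0 < 1 - (1 - μ) * y ^ 2 := by nlinarith [hμ.1, hμ.2, sq_nonneg y]
    exact mul_pos (mul_pos h1 (sub_pos.mpr hy)) h2
  refine ContinuousOn.congr ?_ (fun s hs => legG_eq_cont hs)
  exact (by fun_prop : Continuous fun s : ℝ => s * y ^ 2 * Real.sqrt (1 - s ^ 2)).continuousOn.div
    (by fun_prop : Continuous fun s : ℝ => 2 * Real.sqrt ((1 - μ * s ^ 2) * (1 - y ^ 2) *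
      (1 - (1 - μ) * y ^ 2))).continuousOn
    fun s hs => (mul_pos two_pos (Real.sqrt_pos.mpr (hc s hs))).ne'

/-- `H(x,·,μ)` is continuous on the closed fibre `[0,1]`. -/
theorem continuousOn_legH (hx : x ^ 2 < 1) (hμ : μ ∈ Ioo (0:ℝ) 1) :
    ContinuousOn (fun s => legH x s μ) (Icc 0 1) := by
  have hμ' : 1 - μ ∈ Ioo (0:ℝ) 1 := ⟨sub_pos.mpr hμ.2, sub_lt_self _ hμ.1⟩
  refine ((continuousOn_legG hx hμ' (y := x)).neg).congr fun s _ => ?_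
  exact legH_eq x s μ

/-- `F(x,y,·)` is continuous on `[0,1]` for `(x,y)` in the open square. -/
theorem continuousOn_legF (hx : x ^ 2 < 1) (hy : y ^ 2 < 1) :
    ContinuousOn (fun m => legF x y m) (Icc 0 1) := by
  have hU : Continuous fun m : ℝ => legU x y m := by unfold legU; fun_prop
  exact (by fun_prop : Continuous fun m : ℝ =>
      m * (1 - x ^ 2) + (1 - m) * (1 - y ^ 2)).continuousOn.div hU.sqrt.continuousOn
    fun m hm => (legT_pos hx hy hm).ne'

end calculus

/-! ## Semialgebraicity -/

section semialgebraic

variable {d : ℕ} {W : Set (Fin d → ℝ)} {a b c : (Fin d → ℝ) → ℝ}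
  (ha : IsSemialgebraicFunOn ℚ W a) (hb : IsSemialgebraicFunOn ℚ W b)
  (hc : IsSemialgebraicFunOn ℚ W c)
include ha hb hc

/-- `u` of semialgebraic arguments is semialgebraic. -/
theorem isSemialgebraicFunOn_legU :
    IsSemialgebraicFunOn ℚ W fun w => legU (a w) (b w) (c w) := by
  have h1 := isSemialgebraicFunOn_const_of_isAlgebraic ha.isSemialgebraic_holds isAlgebraic_one
  exact ((((h1.fun_sub (ha.fun_pow 2)).fun_mul (h1.fun_sub (hc.fun_mul (ha.fun_pow 2)))).fun_mul
    (h1.fun_sub (hb.fun_pow 2))).fun_mul (h1.fun_sub ((h1.fun_sub hc).fun_mul (hb.fun_pow 2))))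
    |>.congr fun w _ => by simp only [legU]

/-- `t` of semialgebraic arguments is semialgebraic. -/
theorem isSemialgebraicFunOn_legT :
    IsSemialgebraicFunOn ℚ W fun w => legT (a w) (b w) (c w) :=
  (isSemialgebraicFunOn_legU ha hb hc).fun_sqrt.congr fun w _ => by simp only [legT]

/-- `F` of semialgebraic arguments is semialgebraic. -/
theorem isSemialgebraicFunOn_legF :
    IsSemialgebraicFunOn ℚ W fun w => legF (a w) (b w) (c w) := by
  have h1 := isSemialgebraicFunOn_const_of_isAlgebraic ha.isSemialgebraic_holds isAlgebraic_one
  exact (((hc.fun_mul (h1.fun_sub (ha.fun_pow 2))).fun_add ((h1.fun_sub hc).fun_mul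
    (h1.fun_sub (hb.fun_pow 2)))).fun_mul (isSemialgebraicFunOn_legT ha hb hc).fun_inv).congr
    fun w _ => by simp only [legF, div_eq_mul_inv]

/-- `G` of semialgebraic arguments is semialgebraic. -/
theorem isSemialgebraicFunOn_legG :
    IsSemialgebraicFunOn ℚ W fun w => legG (a w) (b w) (c w) := by
  have h1 := isSemialgebraicFunOn_const_of_isAlgebraic ha.isSemialgebraic_holds isAlgebraic_one
  have h2 := isSemialgebraicFunOn_const_ofNat ha.isSemialgebraic_holds 2
  exact (((ha.fun_mul (hb.fun_pow 2)).fun_mul (h1.fun_sub (ha.fun_pow 2))).fun_mul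
    (h2.fun_mul (isSemialgebraicFunOn_legT ha hb hc)).fun_inv).congr
    fun w _ => by simp only [legG, div_eq_mul_inv]

/-- `∂G/∂x` of semialgebraic arguments is semialgebraic. -/
theorem isSemialgebraicFunOn_legGx :
    IsSemialgebraicFunOn ℚ W fun w => legGx (a w) (b w) (c w) := by
  have h1 := isSemialgebraicFunOn_const_of_isAlgebraic ha.isSemialgebraic_holds isAlgebraic_one
  have h2 := isSemialgebraicFunOn_const_ofNat ha.isSemialgebraic_holds 2
  have hn := ((((hb.fun_pow 2).fun_mul (h1.fun_sub (ha.fun_pow 2))).fun_mul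
    (h1.fun_sub (hb.fun_pow 2))).fun_mul
    (h1.fun_sub ((h1.fun_sub hc).fun_mul (hb.fun_pow 2)))).fun_mul
    ((h1.fun_sub (h2.fun_mul (ha.fun_pow 2))).fun_add (hc.fun_mul (ha.fun_pow 4)))
  exact (hn.fun_mul ((h2.fun_mul (isSemialgebraicFunOn_legU ha hb hc)).fun_mul
    (isSemialgebraicFunOn_legT ha hb hc)).fun_inv).congr
    fun w _ => by simp only [legGx, div_eq_mul_inv]

omit ha hb hc in
/-- `H` of semialgebraic arguments is semialgebraic. -/
theorem isSemialgebraicFunOn_legH (ha : IsSemialgebraicFunOn ℚ W a)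
    (hb : IsSemialgebraicFunOn ℚ W b) (hc : IsSemialgebraicFunOn ℚ W c) :
    IsSemialgebraicFunOn ℚ W fun w => legH (a w) (b w) (c w) := by
  have h1 := isSemialgebraicFunOn_const_of_isAlgebraic ha.isSemialgebraic_holds isAlgebraic_one
  exact (isSemialgebraicFunOn_legG hb ha (h1.fun_sub hc)).fun_neg.congr
    fun w _ => by simp only [legH_eq]

omit ha hb hc in
/-- `∂H/∂y` of semialgebraic arguments is semialgebraic. -/
theorem isSemialgebraicFunOn_legHy (ha : IsSemialgebraicFunOn ℚ W a)
    (hb : IsSemialgebraicFunOn ℚ W b) (hc : IsSemialgebraicFunOn ℚ W c) :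
    IsSemialgebraicFunOn ℚ W fun w => legHy (a w) (b w) (c w) := by
  have h1 := isSemialgebraicFunOn_const_of_isAlgebraic ha.isSemialgebraic_holds isAlgebraic_one
  exact (isSemialgebraicFunOn_legGx hb ha (h1.fun_sub hc)).fun_neg.congr
    fun w _ => by simp only [legHy_eq]

/-- `∂F/∂μ` of semialgebraic arguments is semialgebraic. -/
theorem isSemialgebraicFunOn_legFμ :
    IsSemialgebraicFunOn ℚ W fun w => legFμ (a w) (b w) (c w) :=
  ((isSemialgebraicFunOn_legGx ha hb hc).fun_add (isSemialgebraicFunOn_legHy ha hb hc)).congr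
    fun w _ => by simp only [legFμ]

end semialgebraic

end SoloBlind

end Summit.KontsevichZagierPeriods.KontsevichZagierPeriods.Theorems
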